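import Summits.CriticalPhenomena.PercolationContinuityZ3.Theorems.PercNearOneGluingNoHeavyLowerTailSahiTransportTrace
import Summits.CriticalPhenomena.PercolationContinuityZ3.Theorems.PercNearOneGluingNoHeavyLowerTailSahiTransportLast
import Summits.CriticalPhenomena.PercolationContinuityZ3.Theorems.PercNearOneGluingNoHeavyLowerTailSahiCombPrincipalMeet

/-!
# `NoHeavyLowerTail` (crux stmt-CriticalPhenomena-4575), Sahi / Kahn positivity: the OR OF TWO DISJOINT CYLINDERS slot (I) — sections, probabilities, real inequalities

Support file (cell `prim-l12`, seat P3, gen 8; `--supports stmt-CriticalPhenomena-4575`).  No `sorry`, no named facts, standard axioms.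
New mathematics (this programme).

Preliminaries for `…SahiOrCylinders` (THEOREM: Kahn's Conjecture 5 / Sahi's `C₃` when the first slot is `{S ⊆ ω} ∪ {Sᶜ ⊆ ω}`, the OR of two
disjoint cylinders of a block).  Here: the pattern event `orCyl S`, the law `ρ = μ(· | exactly one of the two cylinders)` (`rho`), the
TRACE-MAXIMAL FAMILIES `hat H 𝒳 = 𝒳^{S} ∩ 𝒳^{Sᶜ}` (product of the two sections `{ω : ω ∪ S ∈ 𝒳}`, `{ω : ω ∪ Sᶜ ∈ 𝒳}`, determined by `Sᶜ`
resp. `S`; `hat_orCyl`), the resulting product formulas for `μ(hat 𝒳)`, `μ(H ∩ hat 𝒳)`, `μ(exactly one ∩ hat 𝒳)` in terms of `P = μ(S open)`,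
`Q = μ(Sᶜ open)` and the section probabilities (independence of the two blocks), and the three real-variable inequalities of the certificate:
* `or_tc_real` — the transport row: with `θ = P+Q−PQ`, `δ = (1−P)(1−Q)`, `π = P+Q−2PQ`,
  `θδ(P y_T + Q y_S − 2PQ) ≤ π[(2−θ)(P y_T + Q y_S − PQ) + θ x_Sx_T z_Sz_T − x_Sx_T(P z_T + Q z_S − PQ) − z_Sz_T(P x_T + Q x_S − PQ)]`
  for `x_S, z_S ∈ [P,1]`, `x_T, z_T ∈ [Q,1]`, `y_S ≥ x_S z_S`, `y_T ≥ x_T z_T`.  PROOF: the difference is affine and increasing in `y_S, y_T`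
  (coefficients `Q(π−PQδ), P(π−PQδ) ≥ 0`, `pi_sub_nonneg`), so put `y = xz`; the result is MULTI-AFFINE in `(x_S,z_S,x_T,z_T)` and is the
  multilinear interpolation of its sixteen vertex values, which are explicit products of nonnegative factors (`or_vertex_nonneg`; three vanish) —
  one `ring` identity;
* `or_o_real` — the domination row: `π(t_S−P)(t_T−Q) ≤ δ[P(t_T−Q) + Q(t_S−P)]`;
* `pi_sub_nonneg` — `(2−θ)π − θδ = π − PQδ = P(1−Q)(1−Q(1−P)) + Q(1−P) ≥ 0` (capacity row). [this work]
-/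

noncomputable section

open scoped Classical

namespace Summit.CriticalPhenomena.PercolationContinuityZ3.Theorems

namespace SahiOrCylinders

open Finset
open SahiHittingSlot SahiTransportCert SahiCombPrincipalMeet
open Literature.Combinatorics.Sahi2008
open Literature.Probability.Percolation (DeterminedBy determinedBy_iff)
open Literature.Probability.Percolation.BHK2006 (ind_inter)
open Literature.Probability.Percolation.DecisionTree (ind ind_of_mem ind_of_not_mem ind_nonneg)

variable {k : ℕ}

/-! ### Real-variable inequalities -/

/-- A point of `[P, 1]` is `P + (1 − P)s` with `s ∈ [0, 1]`. [folklore] -/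
theorem exists_param {P x : ℝ} (hP1 : P ≤ 1) (hPx : P ≤ x) (hx1 : x ≤ 1) : ∃ s : ℝ, 0 ≤ s ∧ s ≤ 1 ∧ x = P + (1 - P) * s := by
  by_cases hP : P < 1
  · have h1 : 0 < 1 - P := sub_pos.2 hP
    refine ⟨(x - P) / (1 - P), div_nonneg (by linarith) h1.le, ?_, ?_⟩
    · rw [div_le_one h1]; linarith
    · field_simp; ring
  · have hP' : P = 1 := le_antisymm hP1 (not_lt.1 hP)
    refine ⟨0, le_rfl, zero_le_one, ?_⟩
    have hx : x = 1 := le_antisymm hx1 (hP' ▸ hPx)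
    rw [hx, hP']; ring

/-- The sixteen-vertex form of the transport inequality: every vertex value is a product of nonnegative factors (here with the
complements `Pb = 1 − P`, … and `θ = P + Q − PQ`, `π = P + Q − 2PQ` as separate nonnegative variables). [this work] -/
theorem or_vertex_nonneg (P Pb Q Qb s sb t tb u ub v vb θ π : ℝ) (hP : 0 ≤ P) (hPb : 0 ≤ Pb) (hQ : 0 ≤ Q) (hQb : 0 ≤ Qb)
    (hs : 0 ≤ s) (hsb : 0 ≤ sb) (ht : 0 ≤ t) (htb : 0 ≤ tb) (hu : 0 ≤ u) (hub : 0 ≤ ub) (hv : 0 ≤ v) (hvb : 0 ≤ vb)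
    (hθ : 0 ≤ θ) (hπ : 0 ≤ π) :
    0 ≤ 2 * P * P * Q * Q * Pb * Pb * Qb * Qb * (sb * tb * ub * vb)
      + P * Q * Pb * Pb * Qb * θ * (sb * tb * ub * v)
      + P * Q * Pb * Pb * Qb * θ * (sb * tb * u * vb)
      + P * Pb * Pb * Qb * (P * Qb * Qb + Q + Q * Q) * (sb * tb * u * v)
      + P * Q * Pb * Qb * Qb * θ * (sb * t * ub * vb)
      + P * Q * Pb * Qb * π * (sb * t * ub * v)
      + P * Q * Q * Pb * Pb * Qb * (sb * t * u * v)
      + P * Q * Pb * Qb * Qb * θ * (s * tb * ub * vb)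
      + P * Q * Pb * Qb * π * (s * tb * u * vb)
      + P * Q * Q * Pb * Pb * Qb * (s * tb * u * v)
      + Q * Pb * Qb * Qb * (Q * Pb * Pb + P + P * P) * (s * t * ub * vb)
      + P * P * Q * Pb * Qb * Qb * (s * t * ub * v)
      + P * P * Q * Pb * Qb * Qb * (s * t * u * vb) := by
  positivity

/-- `π − PQδ ≥ 0`, i.e. `(2 − θ)π ≥ θδ`: the capacity row and the monotonicity of (TC) in the intersection probabilities. [this work] -/
theorem pi_sub_nonneg (P Q : ℝ) (hP : 0 ≤ P) (hP1 : P ≤ 1) (hQ : 0 ≤ Q) (hQ1 : Q ≤ 1) :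
    0 ≤ (P + Q - 2 * (P * Q)) - P * Q * ((1 - P) * (1 - Q)) := by
  have h : (P + Q - 2 * (P * Q)) - P * Q * ((1 - P) * (1 - Q)) = P * (1 - Q) * (1 - Q * (1 - P)) + Q * (1 - P) := by ring
  rw [h]
  have h1 : 0 ≤ 1 - Q * (1 - P) := by nlinarith
  have h1P : 0 ≤ 1 - P := by linarith
  have h1Q : 0 ≤ 1 - Q := by linarith
  exact add_nonneg (mul_nonneg (mul_nonneg hP h1Q) h1) (mul_nonneg hQ h1P)

/-- **The transport inequality for the OR of two disjoint cylinders** (real variables): monotone in `y_S, y_T`, then multi-affine with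
nonnegative vertex values. [this work] -/
theorem or_tc_real (P Q xS zS yS xT zT yT : ℝ) (hP : 0 ≤ P) (hP1 : P ≤ 1) (hQ : 0 ≤ Q) (hQ1 : Q ≤ 1)
    (hxS : P ≤ xS) (hxS1 : xS ≤ 1) (hzS : P ≤ zS) (hzS1 : zS ≤ 1) (hxT : Q ≤ xT) (hxT1 : xT ≤ 1) (hzT : Q ≤ zT) (hzT1 : zT ≤ 1)
    (hyS : xS * zS ≤ yS) (hyT : xT * zT ≤ yT) :
    (P + Q - P * Q) * (1 - (P + Q - P * Q)) * (P * yT + Q * yS - 2 * (P * Q)) ≤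
      ((2 - (P + Q - P * Q)) * (P * yT + Q * yS - P * Q) + (P + Q - P * Q) * ((xT * xS) * (zT * zS))
        - (xT * xS) * (P * zT + Q * zS - P * Q) - (zT * zS) * (P * xT + Q * xS - P * Q)) * (P + Q - 2 * (P * Q)) := by
  obtain ⟨s, hs, hs1, rfl⟩ := exists_param hP1 hxS hxS1
  obtain ⟨t, ht, ht1, rfl⟩ := exists_param hP1 hzS hzS1
  obtain ⟨u, hu, hu1, rfl⟩ := exists_param hQ1 hxT hxT1
  obtain ⟨v, hv, hv1, rfl⟩ := exists_param hQ1 hzT hzT1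
  have hV := or_vertex_nonneg P (1 - P) Q (1 - Q) s (1 - s) t (1 - t) u (1 - u) v (1 - v) (P + Q - P * Q) (P + Q - 2 * (P * Q))
    hP (by linarith) hQ (by linarith) hs (by linarith) ht (by linarith) hu (by linarith) hv (by linarith) (by nlinarith) (by nlinarith)
  have hc := pi_sub_nonneg P Q hP hP1 hQ hQ1
  have hcS : 0 ≤ Q * ((P + Q - 2 * (P * Q)) - P * Q * ((1 - P) * (1 - Q))) * (yS - (P + (1 - P) * s) * (P + (1 - P) * t)) :=
    mul_nonneg (mul_nonneg hQ hc) (by linarith)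
  have hcT : 0 ≤ P * ((P + Q - 2 * (P * Q)) - P * Q * ((1 - P) * (1 - Q))) * (yT - (Q + (1 - Q) * u) * (Q + (1 - Q) * v)) :=
    mul_nonneg (mul_nonneg hP hc) (by linarith)
  -- the identity: RHS − LHS = (sixteen-vertex form) + cS (y_S − x_S z_S) + cT (y_T − x_T z_T)
  have key : ((2 - (P + Q - P * Q)) * (P * yT + Q * yS - P * Q)
        + (P + Q - P * Q) * (((Q + (1 - Q) * u) * (P + (1 - P) * s)) * ((Q + (1 - Q) * v) * (P + (1 - P) * t)))
        - ((Q + (1 - Q) * u) * (P + (1 - P) * s)) * (P * (Q + (1 - Q) * v) + Q * (P + (1 - P) * t) - P * Q)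
        - ((Q + (1 - Q) * v) * (P + (1 - P) * t)) * (P * (Q + (1 - Q) * u) + Q * (P + (1 - P) * s) - P * Q)) * (P + Q - 2 * (P * Q))
      - (P + Q - P * Q) * (1 - (P + Q - P * Q)) * (P * yT + Q * yS - 2 * (P * Q)) =
      (2 * P * P * Q * Q * (1 - P) * (1 - P) * (1 - Q) * (1 - Q) * ((1 - s) * (1 - t) * (1 - u) * (1 - v))
      + P * Q * (1 - P) * (1 - P) * (1 - Q) * (P + Q - P * Q) * ((1 - s) * (1 - t) * (1 - u) * v)
      + P * Q * (1 - P) * (1 - P) * (1 - Q) * (P + Q - P * Q) * ((1 - s) * (1 - t) * u * (1 - v))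
      + P * (1 - P) * (1 - P) * (1 - Q) * (P * (1 - Q) * (1 - Q) + Q + Q * Q) * ((1 - s) * (1 - t) * u * v)
      + P * Q * (1 - P) * (1 - Q) * (1 - Q) * (P + Q - P * Q) * ((1 - s) * t * (1 - u) * (1 - v))
      + P * Q * (1 - P) * (1 - Q) * (P + Q - 2 * (P * Q)) * ((1 - s) * t * (1 - u) * v)
      + P * Q * Q * (1 - P) * (1 - P) * (1 - Q) * ((1 - s) * t * u * v)
      + P * Q * (1 - P) * (1 - Q) * (1 - Q) * (P + Q - P * Q) * (s * (1 - t) * (1 - u) * (1 - v))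
      + P * Q * (1 - P) * (1 - Q) * (P + Q - 2 * (P * Q)) * (s * (1 - t) * u * (1 - v))
      + P * Q * Q * (1 - P) * (1 - P) * (1 - Q) * (s * (1 - t) * u * v)
      + Q * (1 - P) * (1 - Q) * (1 - Q) * (Q * (1 - P) * (1 - P) + P + P * P) * (s * t * (1 - u) * (1 - v))
      + P * P * Q * (1 - P) * (1 - Q) * (1 - Q) * (s * t * (1 - u) * v)
      + P * P * Q * (1 - P) * (1 - Q) * (1 - Q) * (s * t * u * (1 - v)))
      + Q * ((P + Q - 2 * (P * Q)) - P * Q * ((1 - P) * (1 - Q))) * (yS - (P + (1 - P) * s) * (P + (1 - P) * t))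
      + P * ((P + Q - 2 * (P * Q)) - P * Q * ((1 - P) * (1 - Q))) * (yT - (Q + (1 - Q) * u) * (Q + (1 - Q) * v)) := by
    ring
  linarith [hV, hcS, hcT, key]

/-- **The domination row (o) for the OR of two disjoint cylinders** (real variables, denominators cleared). [this work] -/
theorem or_o_real (P Q tS tT : ℝ) (hP : 0 ≤ P) (hQ : 0 ≤ Q) (htS : P ≤ tS) (htS1 : tS ≤ 1) (htT : Q ≤ tT) (htT1 : tT ≤ 1) :
    (tT * tS - (P * tT + Q * tS - P * Q)) * (P + Q - 2 * (P * Q)) ≤ (1 - (P + Q - P * Q)) * (P * tT + Q * tS - 2 * (P * Q)) := by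
  have e1 : (tS - P) * ((tT - Q) * P * (1 - Q)) ≤ (1 - P) * ((tT - Q) * P * (1 - Q)) :=
    mul_le_mul_of_nonneg_right (by linarith) (mul_nonneg (mul_nonneg (by linarith) hP) (by linarith))
  have e2 : (tT - Q) * ((tS - P) * Q * (1 - P)) ≤ (1 - Q) * ((tS - P) * Q * (1 - P)) :=
    mul_le_mul_of_nonneg_right (by linarith) (mul_nonneg (mul_nonneg (by linarith) hQ) (by linarith))
  nlinarith [e1, e2]

/-! ### The pattern event, its trace-maximal families, and the certificate -/

/-- The OR of the two complementary cylinders of the block: all of `S` open or all of `Sᶜ` open. [this work] -/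
def orCyl (S : Set (Fin k)) : Set (Set (Fin k)) := {U | S ⊆ U} ∪ {U | Sᶜ ⊆ U}

/-- "Exactly one of the two cylinders": the OR event without the top pattern. [this work] -/
def exone (S : Set (Fin k)) : Set (Set (Fin k)) := {Set.univ}ᶜ ∩ orCyl S

variable (q : Fin k → unitInterval) (S : Set (Fin k))

/-- **The certificate**: `ρ = μ(· | exactly one of the two cylinders)`. [this work] -/
def rho (T : Set (Fin k)) : ℝ := bernoulliWeight q T * ind (exone S) T / pr q (exone S)

/-- Cylinders are increasing. [folklore] -/
theorem isUpperSet_cylSet (A : Set (Fin k)) : IsUpperSet {U : Set (Fin k) | A ⊆ U} := fun _ _ hle hU => Set.Subset.trans hU hle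

/-- The OR event is increasing. [this work] -/
theorem isUpperSet_orCyl : IsUpperSet (orCyl S) := (isUpperSet_cylSet S).union (isUpperSet_cylSet Sᶜ)

/-- The top pattern lies in the OR event. [this work] -/
theorem univ_mem_orCyl : (Set.univ : Set (Fin k)) ∈ orCyl S := Or.inl (Set.subset_univ S)

/-- The two cylinders meet in the top pattern only. [this work] -/
theorem cyl_inter_cyl_compl : {U : Set (Fin k) | S ⊆ U} ∩ {U | Sᶜ ⊆ U} = {Set.univ} := by
  ext U
  simp only [Set.mem_inter_iff, Set.mem_setOf_eq, Set.mem_singleton_iff]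
  constructor
  · rintro ⟨h1, h2⟩
    exact Set.eq_univ_of_forall fun x => by by_cases hx : x ∈ S; exacts [h1 hx, h2 hx]
  · rintro rfl; exact ⟨Set.subset_univ _, Set.subset_univ _⟩

/-- `ω ∪ Sᶜ = ⊤` when `S ⊆ ω`. [folklore] -/
theorem union_compl_eq_univ_of_subset {S ω : Set (Fin k)} (h : S ⊆ ω) : ω ∪ Sᶜ = Set.univ :=
  Set.eq_univ_of_forall fun x => by by_cases hx : x ∈ S; exacts [Or.inl (h hx), Or.inr hx]

/-- **The trace-maximal families are products of the two sections.** [this work] -/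
theorem hat_orCyl {𝒳 : Set (Set (Fin k))} (h𝒳 : IsUpperSet 𝒳) : hat (orCyl S) 𝒳 = secUnion S 𝒳 ∩ secUnion Sᶜ 𝒳 := by
  ext ω
  simp only [hat, Set.mem_setOf_eq, Set.mem_inter_iff, mem_secUnion]
  constructor
  · intro h
    exact ⟨h _ Set.subset_union_left (Or.inl Set.subset_union_right), h _ Set.subset_union_left (Or.inr Set.subset_union_right)⟩
  · rintro ⟨hS, hSc⟩ T hωT (hT | hT)
    · exact h𝒳 (Set.union_subset hωT hT) hS
    · exact h𝒳 (Set.union_subset hωT hT) hSc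

/-- The trace-maximal family of the empty family is empty (the top pattern completes everything). [this work] -/
theorem hat_empty : hat (orCyl S) (∅ : Set (Set (Fin k))) = ∅ :=
  Set.eq_empty_of_forall_notMem fun ω h => h Set.univ (Set.subset_univ ω) (univ_mem_orCyl S)

/-- `hat` of an intersection. [this work] -/
theorem hat_inter (Hk 𝒳 𝒵 : Set (Set (Fin k))) : hat Hk (𝒳 ∩ 𝒵) = hat Hk 𝒳 ∩ hat Hk 𝒵 := by
  ext ω
  simp only [hat, Set.mem_setOf_eq, Set.mem_inter_iff]
  exact ⟨fun h => ⟨fun T h1 h2 => (h T h1 h2).1, fun T h1 h2 => (h T h1 h2).2⟩, fun h T h1 h2 => ⟨h.1 T h1 h2, h.2 T h1 h2⟩⟩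

/-- The cylinder over `S` lies in the `Sᶜ`-section of a family containing the top pattern. [this work] -/
theorem cyl_subset_secUnion_compl {𝒳 : Set (Set (Fin k))} (huniv : Set.univ ∈ 𝒳) : {U : Set (Fin k) | S ⊆ U} ⊆ secUnion Sᶜ 𝒳 :=
  fun U hU => by rw [mem_secUnion, union_compl_eq_univ_of_subset hU]; exact huniv

/-- The cylinder over `Sᶜ` lies in the `S`-section of a family containing the top pattern. [this work] -/
theorem cyl_compl_subset_secUnion {𝒳 : Set (Set (Fin k))} (huniv : Set.univ ∈ 𝒳) : {U : Set (Fin k) | Sᶜ ⊆ U} ⊆ secUnion S 𝒳 := by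
  have h := cyl_subset_secUnion_compl Sᶜ (𝒳 := 𝒳) huniv
  rwa [compl_compl] at h

/-- The top pattern lies in every section of a family containing it. [this work] -/
theorem univ_mem_secUnion (A : Set (Fin k)) {𝒳 : Set (Set (Fin k))} (huniv : Set.univ ∈ 𝒳) : Set.univ ∈ secUnion A 𝒳 := by
  rw [mem_secUnion, Set.univ_union]; exact huniv

/-! ### Probabilities: independence of the two blocks -/

/-- Independence across the two blocks. [folklore] -/
theorem pr_inter_indep {X Y : Set (Set (Fin k))} (hX : DeterminedBy X Sᶜ) (hY : DeterminedBy Y S) :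
    pr q (X ∩ Y) = pr q X * pr q Y :=
  ex_ind_inter_of_determinedBy_compl q S hX hY

/-- The `Sᶜ`-section is determined by `S`. [this work] -/
theorem determinedBy_secUnion_compl (𝒳 : Set (Set (Fin k))) : DeterminedBy (secUnion Sᶜ 𝒳) S := by
  have h := determinedBy_secUnion Sᶜ 𝒳
  rwa [compl_compl] at h

/-- `μ(both cylinders) = P·Q`. [this work] -/
theorem pr_cyl_inter_cyl_compl : pr q ({U : Set (Fin k) | S ⊆ U} ∩ {U | Sᶜ ⊆ U}) = pr q {U : Set (Fin k) | S ⊆ U} * pr q {U | Sᶜ ⊆ U} := by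
  rw [Set.inter_comm, mul_comm]
  exact pr_inter_indep q S (determinedBy_cylinder Sᶜ) (determinedBy_cylinder S)

/-- `μ(⊤) = P·Q`. [this work] -/
theorem pr_top : pr q ({Set.univ} : Set (Set (Fin k))) = pr q {U : Set (Fin k) | S ⊆ U} * pr q {U | Sᶜ ⊆ U} := by
  rw [← cyl_inter_cyl_compl S]; exact pr_cyl_inter_cyl_compl q S

/-- `μ(⊤) = ∏ q_i`. [folklore] -/
theorem pr_top_eq_prod : pr q ({Set.univ} : Set (Set (Fin k))) = ∏ i, (q i : ℝ) := by
  have hnot : ∀ T : Set (Fin k), T ≠ Set.univ → T ∉ ({Set.univ} : Set (Set (Fin k))) := fun T hT h => hT (Set.mem_singleton_iff.1 h)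
  rw [pr_eq_sum, sum_eq_single (Set.univ : Set (Fin k)) (fun T _ hT => by rw [ind_of_not_mem (hnot T hT), mul_zero])
    (fun h => (h (mem_univ _)).elim), ind_of_mem (Set.mem_singleton _), mul_one]
  have bw : ∀ T : Set (Fin k), bernoulliWeight q T = ∏ e, (if e ∈ T then (q e : ℝ) else 1 - (q e : ℝ)) := fun _ => rfl
  rw [bw]
  exact prod_congr rfl fun e _ => if_pos (Set.mem_univ e)

/-- `θ = μ(H) = P + Q − PQ`. [this work] -/
theorem pr_orCyl : pr q (orCyl S) = pr q {U : Set (Fin k) | S ⊆ U} + pr q {U | Sᶜ ⊆ U} - pr q {U : Set (Fin k) | S ⊆ U} * pr q {U | Sᶜ ⊆ U} := by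
  rw [orCyl, pr_union, pr_cyl_inter_cyl_compl]

/-- `π = μ(exactly one) = P + Q − 2PQ`. [this work] -/
theorem pr_exone : pr q (exone S) = pr q {U : Set (Fin k) | S ⊆ U} + pr q {U | Sᶜ ⊆ U} - 2 * (pr q {U : Set (Fin k) | S ⊆ U} * pr q {U | Sᶜ ⊆ U}) := by
  rw [exone, pr_compl_inter, pr_orCyl, Set.inter_eq_left.2 (Set.singleton_subset_iff.2 (univ_mem_orCyl S)), pr_top]
  ring

section Hat

variable {𝒴 : Set (Set (Fin k))} (h𝒴 : IsUpperSet 𝒴) (huniv : Set.univ ∈ 𝒴)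
include h𝒴

/-- `μ(hat 𝒴) = y_T · y_S`. [this work] -/
theorem pr_hat : pr q (hat (orCyl S) 𝒴) = pr q (secUnion S 𝒴) * pr q (secUnion Sᶜ 𝒴) := by
  rw [hat_orCyl S h𝒴]; exact pr_inter_indep q S (determinedBy_secUnion S 𝒴) (determinedBy_secUnion_compl S 𝒴)

include huniv

/-- `μ(H ∩ hat 𝒴) = P·y_T + Q·y_S − PQ`. [this work] -/
theorem pr_orCyl_inter_hat : pr q (orCyl S ∩ hat (orCyl S) 𝒴) =
    pr q {U : Set (Fin k) | S ⊆ U} * pr q (secUnion S 𝒴) + pr q {U : Set (Fin k) | Sᶜ ⊆ U} * pr q (secUnion Sᶜ 𝒴)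
      - pr q {U : Set (Fin k) | S ⊆ U} * pr q {U | Sᶜ ⊆ U} := by
  have hA : {U : Set (Fin k) | S ⊆ U} ∩ (secUnion S 𝒴 ∩ secUnion Sᶜ 𝒴) = secUnion S 𝒴 ∩ {U : Set (Fin k) | S ⊆ U} := by
    ext U
    simp only [Set.mem_inter_iff]
    exact ⟨fun h => ⟨h.2.1, h.1⟩, fun h => ⟨h.2, h.1, cyl_subset_secUnion_compl S huniv h.2⟩⟩
  have hB : {U : Set (Fin k) | Sᶜ ⊆ U} ∩ (secUnion S 𝒴 ∩ secUnion Sᶜ 𝒴) = {U : Set (Fin k) | Sᶜ ⊆ U} ∩ secUnion Sᶜ 𝒴 := by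
    ext U
    simp only [Set.mem_inter_iff]
    exact ⟨fun h => ⟨h.1, h.2.2⟩, fun h => ⟨h.1, cyl_compl_subset_secUnion S huniv h.1, h.2⟩⟩
  have hAB : secUnion S 𝒴 ∩ {U : Set (Fin k) | S ⊆ U} ∩ ({U : Set (Fin k) | Sᶜ ⊆ U} ∩ secUnion Sᶜ 𝒴) = {Set.univ} := by
    rw [← cyl_inter_cyl_compl S]
    ext U
    simp only [Set.mem_inter_iff]
    exact ⟨fun h => ⟨h.1.2, h.2.1⟩, fun h => ⟨⟨cyl_compl_subset_secUnion S huniv h.2, h.1⟩, h.2, cyl_subset_secUnion_compl S huniv h.1⟩⟩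
  rw [hat_orCyl S h𝒴, orCyl, Set.union_inter_distrib_right, pr_union, hA, hB, hAB, pr_top,
    pr_inter_indep q S (determinedBy_secUnion S 𝒴) (determinedBy_cylinder S),
    pr_inter_indep q S (determinedBy_cylinder Sᶜ) (determinedBy_secUnion_compl S 𝒴)]
  ring

/-- `μ(exactly one ∩ hat 𝒴) = P·y_T + Q·y_S − 2PQ`. [this work] -/
theorem pr_exone_inter_hat : pr q (exone S ∩ hat (orCyl S) 𝒴) =
    pr q {U : Set (Fin k) | S ⊆ U} * pr q (secUnion S 𝒴) + pr q {U : Set (Fin k) | Sᶜ ⊆ U} * pr q (secUnion Sᶜ 𝒴)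
      - 2 * (pr q {U : Set (Fin k) | S ⊆ U} * pr q {U | Sᶜ ⊆ U}) := by
  have htop : ({Set.univ} : Set (Set (Fin k))) ∩ (orCyl S ∩ hat (orCyl S) 𝒴) = {Set.univ} := by
    refine Set.inter_eq_left.2 (Set.singleton_subset_iff.2 ⟨univ_mem_orCyl S, ?_⟩)
    rw [hat_orCyl S h𝒴]; exact ⟨univ_mem_secUnion S huniv, univ_mem_secUnion Sᶜ huniv⟩
  rw [exone, Set.inter_assoc, pr_compl_inter, pr_orCyl_inter_hat q S h𝒴 huniv, htop, pr_top]
  ring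

/-- `μ(Hᶜ ∩ hat 𝒴) = y_T y_S − (P·y_T + Q·y_S − PQ)`. [this work] -/
theorem pr_compl_inter_hat : pr q ((orCyl S)ᶜ ∩ hat (orCyl S) 𝒴) =
    pr q (secUnion S 𝒴) * pr q (secUnion Sᶜ 𝒴) - (pr q {U : Set (Fin k) | S ⊆ U} * pr q (secUnion S 𝒴)
      + pr q {U : Set (Fin k) | Sᶜ ⊆ U} * pr q (secUnion Sᶜ 𝒴) - pr q {U : Set (Fin k) | S ⊆ U} * pr q {U | Sᶜ ⊆ U}) := by
  rw [pr_compl_inter, pr_hat q S h𝒴, pr_orCyl_inter_hat q S h𝒴 huniv]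

end Hat

/-- Sums against `ρ`: `Σ_T ρ(T) 1_𝒲(T) = μ(exactly one ∩ 𝒲)/π`. [this work] -/
theorem sum_rho_ind (𝒲 : Set (Set (Fin k))) : ∑ T, rho q S T * ind 𝒲 T = pr q (exone S ∩ 𝒲) / pr q (exone S) := by
  rw [pr_eq_sum q (exone S ∩ 𝒲), Finset.sum_div]
  refine sum_congr rfl fun T _ => ?_
  rw [rho, ind_inter]; ring

end SahiOrCylinders

end Summit.CriticalPhenomena.PercolationContinuityZ3.Theorems
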